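import Literature.NumberTheory.GaloisRepresentations.ArtinRepFrobenius
import Literature.NumberTheory.GaloisRepresentations.FrobeniusDensityTheorem
import Literature.RepresentationTheory.FiniteGroups.TracePowCharpoly
import Literature.NumberTheory.GaloisRepresentations.IntegralGaloisActionProofs
import Literature.NumberTheory.LFunctions.ChebotarevDensity
import Literature.NumberTheory.LFunctions.DirichletDensityLemmas
import Literature.RepresentationTheory.FiniteGroups.EquivOfCharacter
import Mathlib.LinearAlgebra.Matrix.Permutation
import Mathlib.Topology.Algebra.Module.FiniteDimension
import HarnessLib

/-!
# Proof of Deligne–Serre 1974, Lemme 3.2 (complex case)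

This file PROVES the named fact `Literature.NumberTheory.GaloisRepresentations.DeligneSerre1974.lemma32_complex`
(`Literature.NumberTheory.GaloisRepresentations.ArtinRepFrobenius`; Deligne–Serre 1974,
Lemme 3.2 with Rem. 3.3: two finite-image continuous representations
`ρ, ρ' : Gal(ℚ̄/ℚ) → GL_n(ℂ)` with the same Frobenius characteristic polynomials outside a finite
set `S` are isomorphic), twice:

* `lemma32_complex_of` — modulo the Chebotarev density theorem
  (`Literature.NumberTheory.LFunctions.Chebotarev.dirichletDensity_eq`), following the printed proof: "l'ensemble des `F_{v,ρ}`
  est dense dans `G/I`" (Chebotarev), so that `Tr ρ = Tr ρ'` everywhere, and a complex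
  representation of a finite group is determined by its character
  (`Literature.RepresentationTheory.FiniteGroups.Representation.nonempty_equiv_of_character_eq`,
  `Literature.RepresentationTheory.FiniteGroups.EquivOfCharacter`, replacing the Brauer–Nesbitt
  reference [3, 30.16] of the source, which is only needed in positive characteristic);
* `lemma32_complex_holds` — **unconditionally**, with Chebotarev (1922) replaced by Frobenius'
  density theorem (1896) for divisions, which is PROVED in the tree
  (`Literature.NumberTheory.GaloisRepresentations.FramedGaloisRep.infinite_setOf_frobenius_mem_division`,
  `GaloisRepresentations/FrobeniusDensityTheorem`; Marcus, *Number Fields*, Ch. 7, Exercise 12 (f)):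
  every `q ∈ (ρ × ρ')(G)` has a generator `q ^ k`, `(k, ord q) = 1`, of `⟨q⟩` that is a Frobenius
  at some `p ∉ S` (`exists_frob_eq_pow`), and equality of the *characteristic polynomials* of
  `ρ(q^k)`, `ρ'(q^k)` (finite-order matrices over `ℂ`) gives equality of the traces of all their
  powers (`Literature.RepresentationTheory.FiniteGroups.TracePow.matrix_trace_pow_eq_of_charpoly_eq`,
  `RepresentationTheory/FiniteGroups/TracePowCharpoly`), in particular of
  `ρ(q) = ρ(q^k)^{k'}`, `ρ'(q)`, `k k' ≡ 1 (mod ord q)`.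

## References

* P. Deligne, J.-P. Serre, *Formes modulaires de poids 1*, Ann. Sci. ÉNS (4) 7 (1974), Lemme 3.2,
  Rem. 3.3 (p. 513). [DeligneSerreASENS1974]
* D. A. Marcus, *Number Fields*, 2nd ed., Universitext, Springer (2018), Ch. 7, Exercise 12 (f)
  (the Frobenius Density Theorem). [Marcus2018]
-/

noncomputable section

open scoped NumberField MatrixGroups Pointwise
open IsDedekindDomain Rat.HeightOneSpectrum Field

namespace Literature.NumberTheory.GaloisRepresentations.DeligneSerre1974

/-- A fibre of a continuous map with finite image into a `T₁` space is open. [folklore] -/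
lemma isOpen_fiber_of_finite_range {X Y : Type*} [TopologicalSpace X] [TopologicalSpace Y]
    [T1Space Y] {f : X → Y} (hf : Continuous f) (hfin : (Set.range f).Finite) (y : Y) :
    IsOpen (f ⁻¹' {y}) := by
  have : f ⁻¹' {y} = (f ⁻¹' (Set.range f \ {y}))ᶜ := by
    ext x
    simp
  rw [this, isOpen_compl_iff]
  exact ((hfin.subset Set.sdiff_subset).isClosed).preimage hf

/-- Matrices with equal characteristic polynomials have equal traces. [folklore] -/
lemma trace_eq_of_charpoly_eq {n : ℕ} {M M' : Matrix (Fin n) (Fin n) ℂ}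
    (h : M.charpoly = M'.charpoly) : M.trace = M'.trace := by
  rcases Nat.eq_zero_or_pos n with rfl | hn
  · simp [Matrix.trace]
  · haveI : Nonempty (Fin n) := ⟨⟨0, hn⟩⟩
    rw [Matrix.trace_eq_neg_charpoly_coeff, Matrix.trace_eq_neg_charpoly_coeff, h]

/-- **Every element of a finite Galois image is a Frobenius** (Chebotarev; the density
statement "l'ensemble des `F_{v}` est dense" of Deligne–Serre 1974, proof of Lemme 3.2). For a
surjection `φ : Gal(ℚ̄/ℚ) → Q` onto a finite group with open kernel and a finite set `S` of
primes, every `q ∈ Q` is `φ(σ)` for an arithmetic Frobenius `σ` at a prime above some `p ∉ S`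
at which `φ` is unramified. [folklore] -/
theorem exists_frob_eq (hCheb : LFunctions.Chebotarev.dirichletDensity_eq.{0}) {Q : Type} [Group Q]
    [Finite Q] (φ : absoluteGaloisGroup ℚ →* Q)
    (hker : IsOpen ((φ.ker : Subgroup (absoluteGaloisGroup ℚ)) : Set (absoluteGaloisGroup ℚ)))
    (hsurj : Function.Surjective φ) (S : Finset ℕ) (q : Q) :
    ∃ (v : HeightOneSpectrum (𝓞 ℚ)), ((primesEquiv v : Nat.Primes) : ℕ) ∉ S ∧
      (∀ 𝔓 ∈ v.primesAbove, ∀ σ ∈ 𝔓.inertia (absoluteGaloisGroup ℚ), φ σ = 1) ∧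
      ∃ 𝔓 ∈ v.primesAbove, ∃ σ : absoluteGaloisGroup ℚ, IsArithFrobAt (𝓞 ℚ) σ 𝔓 ∧ φ σ = q := by
  classical
  -- the conjugacy class of `q`
  set C : Set Q := {x | ∃ g : Q, g * q * g⁻¹ = x} with hC
  have hCconj : ∀ g h : Q, h ∈ C → g * h * g⁻¹ ∈ C := by
    rintro g _ ⟨g', rfl⟩
    exact ⟨g * g', by group⟩
  have hd := hCheb φ hker hsurj C hCconj
  haveI : Finite C := Subtype.finite
  have hCpos : 0 < Nat.card C := Nat.card_pos_iff.mpr ⟨⟨⟨q, 1, by group⟩⟩, inferInstance⟩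
  have hpos : (0 : ℝ) < (Nat.card C : ℝ) / Nat.card Q :=
    div_pos (Nat.cast_pos.mpr hCpos) (Nat.cast_pos.mpr Nat.card_pos)
  obtain ⟨p, hp, hpC, hpS⟩ := LFunctions.PrimeSum.exists_gt_of_tendsto_pos hpos hd (S.sup id)
  obtain ⟨v, rfl, hunr, hfrob⟩ := hpC
  refine ⟨v, fun h ↦ (not_lt.mpr (Finset.le_sup (f := id) h)) hpS, hunr, ?_⟩
  obtain ⟨𝔓, h𝔓⟩ := HeightOneSpectrum.primesAbove_nonempty v
  obtain ⟨σ, hσ⟩ := HeightOneSpectrum.exists_isArithFrobAt_of_mem_primesAbove_holds h𝔓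
  obtain ⟨g, hg⟩ := hfrob 𝔓 h𝔓 σ hσ
  obtain ⟨τ, rfl⟩ := hsurj g
  -- conjugate back: `q = φ (τ⁻¹ σ τ)`, a Frobenius at `τ⁻¹ • 𝔓`
  refine ⟨τ⁻¹ • 𝔓, ?_, τ⁻¹ * σ * τ⁻¹⁻¹, hσ.conj τ⁻¹, ?_⟩
  · rw [HeightOneSpectrum.mem_primesAbove_iff] at h𝔓 ⊢
    obtain ⟨h1, h2⟩ := h𝔓
    exact ⟨Ideal.IsPrime.smul _, Ideal.LiesOver.smul _⟩
  · rw [map_mul, map_mul, inv_inv, map_inv, ← hg]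
    group

/-- **Deligne–Serre 1974, Lemme 3.2 (complex case), from Chebotarev.** Two continuous
representations `ρ, ρ' : Gal(ℚ̄/ℚ) → GL_n(ℂ)` with finite image, unramified outside a finite
set `S` with the same Frobenius characteristic polynomials there, are isomorphic: both factor
through the finite group `Q = (ρ × ρ')(Gal)`, every element of which is a Frobenius at some
`p ∉ S` (`exists_frob_eq`), so the two representations of `Q` have the same character and are
equivalent (`Literature.RepresentationTheory.FiniteGroups.Representation.nonempty_equiv_of_character_eq`). This discharges the named fact
`lemma32_complex` modulo `Chebotarev.dirichletDensity_eq` (the semisimplicity hypotheses of the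
fact are not needed over `ℂ`). [cite: DeligneSerreASENS1974, Lemme 3.2 and Rem. 3.3] -/
theorem lemma32_complex_of (hCheb : LFunctions.Chebotarev.dirichletDensity_eq.{0}) : lemma32_complex := by
  intro n S ρ ρ' hfin hfin' _ _ hST
  classical
  -- the finite group `Q = (ρ × ρ')(Γ)` and `φ : Γ → Q`
  set π : absoluteGaloisGroup ℚ →* GL (Fin n) ℂ × GL (Fin n) ℂ :=
    (ρ : absoluteGaloisGroup ℚ →* GL (Fin n) ℂ).prod (ρ' : absoluteGaloisGroup ℚ →* GL (Fin n) ℂ)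
    with hπ
  set Q : Subgroup (GL (Fin n) ℂ × GL (Fin n) ℂ) := π.range with hQ
  haveI : Finite Q := by
    have h1 : (Set.range π).Finite := by
      refine (hfin.prod hfin').subset ?_
      rintro _ ⟨σ, rfl⟩
      exact ⟨⟨σ, rfl⟩, ⟨σ, rfl⟩⟩
    exact Set.Finite.to_subtype (s := ((Q : Subgroup (GL (Fin n) ℂ × GL (Fin n) ℂ)) :
      Set (GL (Fin n) ℂ × GL (Fin n) ℂ))) (by rw [hQ, MonoidHom.coe_range]; exact h1)
  letI : Fintype Q := Fintype.ofFinite Q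
  set φ : absoluteGaloisGroup ℚ →* Q := π.rangeRestrict with hφ
  have hφsurj : Function.Surjective φ := MonoidHom.rangeRestrict_surjective π
  have hφ_coe : ∀ σ, ((φ σ : Q) : GL (Fin n) ℂ × GL (Fin n) ℂ) = (ρ σ, ρ' σ) := fun σ ↦ rfl
  have hker : IsOpen ((φ.ker : Subgroup (absoluteGaloisGroup ℚ)) :
      Set (absoluteGaloisGroup ℚ)) := by
    have h1 := isOpen_fiber_of_finite_range ρ.continuous hfin 1
    have h2 := isOpen_fiber_of_finite_range ρ'.continuous hfin' 1
    have : ((φ.ker : Subgroup (absoluteGaloisGroup ℚ)) : Set (absoluteGaloisGroup ℚ)) =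
        ρ ⁻¹' {1} ∩ ρ' ⁻¹' {1} := by
      ext σ
      simp only [SetLike.mem_coe, MonoidHom.mem_ker, Set.mem_inter_iff, Set.mem_preimage,
        Set.mem_singleton_iff, ← Subtype.coe_inj, hφ_coe, OneMemClass.coe_one, Prod.mk_eq_one]
    rw [this]
    exact h1.inter h2
  -- the two representations of `Q` on `ℂⁿ`
  set τ : Representation ℂ Q (Fin n → ℂ) :=
    (glStdRepresentation (Fin n) ℂ).comp ((MonoidHom.fst _ _).comp Q.subtype) with hτ
  set τ' : Representation ℂ Q (Fin n → ℂ) :=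
    (glStdRepresentation (Fin n) ℂ).comp ((MonoidHom.snd _ _).comp Q.subtype) with hτ'
  have hτρ : ∀ σ, τ (φ σ) = FramedRep.toRepresentation ρ σ := fun σ ↦ rfl
  have hτρ' : ∀ σ, τ' (φ σ) = FramedRep.toRepresentation ρ' σ := fun σ ↦ rfl
  -- equal characters
  have hchar : τ.character = τ'.character := by
    ext q
    obtain ⟨v, hvS, -, 𝔓, h𝔓, σ, hσ, rfl⟩ := exists_frob_eq hCheb φ hker hφsurj S q
    obtain ⟨-, -, P, hP, hP'⟩ := hST v hvS
    have h1 := hP 𝔓 h𝔓 σ hσ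
    have h2 := hP' 𝔓 h𝔓 σ hσ
    simp only [FramedRep.charpoly] at h1 h2
    have htr := trace_eq_of_charpoly_eq (h1.trans h2.symm)
    rw [Representation.character, Representation.character, hτρ, hτρ']
    have e1 : ∀ (ψ : FramedGaloisRep ℚ ℂ n), FramedRep.toRepresentation ψ σ =
        Matrix.toLin' ((ψ σ : GL (Fin n) ℂ) : Matrix (Fin n) (Fin n) ℂ) := fun ψ ↦
      LinearMap.ext fun w ↦ by simp [Matrix.toLin'_apply]
    rw [e1, e1, Matrix.trace_toLin'_eq, Matrix.trace_toLin'_eq, htr]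
  -- the representations of `Q` are equivalent, hence so are `ρ` and `ρ'`
  obtain ⟨e⟩ := Literature.RepresentationTheory.FiniteGroups.Representation.nonempty_equiv_of_character_eq τ τ' hchar
  refine ⟨{ toRepEquiv := Representation.Equiv.mk e.toLinearEquiv fun σ ↦ ?_,
            continuous_toFun := ?_, continuous_invFun := ?_ }⟩
  · have := e.isIntertwining' (φ σ)
    rw [hτρ, hτρ'] at this
    exact this
  · exact e.toLinearEquiv.toLinearMap.continuous_of_finiteDimensional
  · exact e.toLinearEquiv.symm.toLinearMap.continuous_of_finiteDimensional


/-! ### Unconditional proof: Frobenius' density theorem (divisions) in place of Chebotarev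

The printed proof of Lemme 3.2 uses Chebotarev only through "every element of the finite group
`(ρ × ρ')(G)` is a Frobenius at some `p ∉ S`".  Frobenius' own density theorem (1896) — PROVED in
the tree (`Literature.NumberTheory.GaloisRepresentations.FramedGaloisRep.infinite_setOf_frobenius_mem_division`,
`GaloisRepresentations/FrobeniusDensityTheorem`) — gives this only up to *divisions*: every `q` has
a generator `q ^ k`, `(k, ord q) = 1`, of `⟨q⟩` which is such a Frobenius.  Since the hypothesis of
`lemma32_complex` is equality of Frobenius *characteristic polynomials* (not merely traces), this
suffices: `χ(ρ(q^k)) = χ(ρ'(q^k))` for matrices of finite order gives `tr ρ(q^{kk'}) = tr ρ'(q^{kk'})`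
for all `k'` (`Literature.RepresentationTheory.FiniteGroups.TracePow.matrix_trace_pow_eq_of_charpoly_eq`,
`RepresentationTheory/FiniteGroups/TracePowCharpoly`), and `k k' ≡ 1 (mod ord q)` recovers
`tr ρ(q) = tr ρ'(q)`.  The rest of the argument is that of `lemma32_complex_of`. -/

/-- **A finite group embeds in `GL_{|Q|}(ℂ)`**: the regular permutation representation by
permutation matrices on `Fin |Q|` (Mathlib `MulAction.toPermHom`, `Equiv.permCongrHom`,
`Matrix.permMatrixHom`), faithful because left multiplication is faithful and a permutation
matrix determines the permutation (`PEquiv.toMatrix_injective`); cf. the same construction for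
`Gal(E/K)` in `GaloisRepresentations/FrobeniusDensity`. [folklore] -/
theorem exists_injective_toGL (Q : Type*) [Group Q] [Fintype Q] :
    ∃ π : Q →* GL (Fin (Fintype.card Q)) ℂ, Function.Injective π := by
  classical
  let e := Fintype.equivFin Q
  let π : Q →* GL (Fin (Fintype.card Q)) ℂ :=
    ((Matrix.permMatrixHom (R := ℂ)).comp
      (e.permCongrHom.toMonoidHom.comp (MulAction.toPermHom Q Q))).toHomUnits
  refine ⟨π, fun g h hgh ↦ ?_⟩
  have h1 := congrArg Units.val hgh
  simp only [π, MonoidHom.coe_toHomUnits, MonoidHom.coe_comp, Function.comp_apply,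
    Matrix.permMatrixHom_apply, MulEquiv.coe_toMonoidHom] at h1
  have h2 := PEquiv.toMatrix_injective h1
  have h3 : e.permCongrHom (MulAction.toPermHom _ _ g) =
      e.permCongrHom (MulAction.toPermHom _ _ h) := by
    refine inv_injective (Equiv.ext fun x ↦ ?_)
    have hx := congrArg (fun f : PEquiv _ _ ↦ f x) h2
    simpa only [Equiv.toPEquiv_apply, Option.some.injEq] using hx
  exact MulAction.toPerm_injective (e.permCongrHom.injective h3)

/-- **Every element of a finite Galois image is a Frobenius up to its division — PROVED**
(Frobenius' density theorem of 1896 in place of Chebotarev's).  For a homomorphism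
`φ : Gal(ℚ̄/ℚ) → Q` to a finite group with open kernel, a finite set `S` of primes and
`g ∈ Gal(ℚ̄/ℚ)`, there are a prime `p ∉ S` and an arithmetic Frobenius `σ` at a prime of `\bar ℤ`
above `p` with `φ σ = φ g ^ k` for some `k` prime to the order of `φ g`: apply
`Literature.NumberTheory.GaloisRepresentations.FramedGaloisRep.infinite_setOf_frobenius_mem_division` to the Artin representation
`π ∘ φ`, `π` a faithful complex representation of `Q` (`exists_injective_toGL`), continuous
because its kernel `ker φ` is open, and discard the finitely many places in `S`.
[cite: Marcus2018, Ch. 7, Exercise 12 (f)] -/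
theorem exists_frob_eq_pow {Q : Type} [Group Q] [Finite Q] (φ : absoluteGaloisGroup ℚ →* Q)
    (hker : IsOpen ((φ.ker : Subgroup (absoluteGaloisGroup ℚ)) : Set (absoluteGaloisGroup ℚ)))
    (S : Finset ℕ) (g : absoluteGaloisGroup ℚ) :
    ∃ (v : HeightOneSpectrum (𝓞 ℚ)), ((primesEquiv v : Nat.Primes) : ℕ) ∉ S ∧
      ∃ 𝔓 ∈ v.primesAbove, ∃ σ : absoluteGaloisGroup ℚ, IsArithFrobAt (𝓞 ℚ) σ 𝔓 ∧
        ∃ k : ℕ, k.Coprime (orderOf (φ g)) ∧ φ σ = φ g ^ k := by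
  classical
  letI : Fintype Q := Fintype.ofFinite Q
  obtain ⟨π, hπ⟩ := exists_injective_toGL Q
  -- the Artin representation `π ∘ φ`, continuous since its kernel `ker φ` is open
  have hkerπ : (π.comp φ).ker = φ.ker := by
    ext σ
    simp only [MonoidHom.mem_ker, MonoidHom.coe_comp, Function.comp_apply]
    constructor
    · intro h
      exact hπ (h.trans (map_one π).symm)
    · intro h
      rw [h, map_one]
  have hkerπ' : IsOpen ((π.comp φ).ker : Set (absoluteGaloisGroup ℚ)) := by
    rw [hkerπ]; exact hker
  -- a homomorphism with open kernel is continuous (cf. `MonoidHom.continuous_of_isOpen_ker` in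
  -- `Automorphic/LanglandsTetrahedral`, not imported here)
  have hcont : Continuous (π.comp φ) := by
    apply continuous_of_continuousAt_one (π.comp φ)
    rw [ContinuousAt, map_one]
    intro U hU
    rw [Filter.mem_map]
    apply Filter.mem_of_superset (hkerπ'.mem_nhds (by simp))
    intro γ hγ
    rw [SetLike.mem_coe, MonoidHom.mem_ker] at hγ
    rw [Set.mem_preimage, hγ]
    exact mem_of_mem_nhds hU
  let ρ : FramedGaloisRep ℚ ℂ (Fintype.card Q) :=
    { toMonoidHom := π.comp φ
      continuous_toFun := hcont }
  have hρ : ∀ σ, ρ σ = π (φ σ) := fun σ ↦ rfl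
  have hρker : IsOpen (ρ.toMonoidHom.ker : Set (absoluteGaloisGroup ℚ)) := hkerπ'
  have hinf := ρ.infinite_setOf_frobenius_mem_division hρker g
  -- only finitely many places lie in `S`
  have hSfin : {v : HeightOneSpectrum (𝓞 ℚ) | ((primesEquiv v : Nat.Primes) : ℕ) ∈ S}.Finite :=
    S.finite_toSet.preimage (Nat.Primes.coe_nat_injective.comp primesEquiv.injective).injOn
  obtain ⟨v, ⟨-, 𝔓, h𝔓, σ, hσ, k, hk, hρσ⟩, hvS⟩ := hinf.exists_notMem_finite hSfin
  refine ⟨v, hvS, 𝔓, h𝔓, σ, hσ, k, ?_, ?_⟩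
  · have : orderOf (ρ g) = orderOf (φ g) := by
      rw [hρ]
      exact orderOf_injective π hπ (φ g)
    rwa [this] at hk
  · apply hπ
    rw [map_pow, ← hρ, ← hρ]
    exact hρσ

/-- **Deligne–Serre 1974, Lemme 3.2 (complex case) — PROVED, unconditionally.**  Two continuous
representations `ρ, ρ' : Gal(ℚ̄/ℚ) → GL_n(ℂ)` with finite image, unramified outside a finite set
`S` with the same Frobenius characteristic polynomials there, are isomorphic.  Proof: both factor
through the finite group `Q = (ρ × ρ')(Gal)` (`φ : Gal → Q`, open kernel); for `q = φ g ∈ Q`,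
Frobenius' density theorem (`exists_frob_eq_pow`) provides a Frobenius `σ` at some `p ∉ S` with
`φ σ = q ^ k`, `(k, ord q) = 1`, so `χ(ρ g ^ k) = χ(ρ' g ^ k)`; as `ρ g`, `ρ' g` have finite order
dividing `m = ord q`, `tr((ρ g)^{k k'}) = tr((ρ' g)^{k k'})` for all `k'`
(`Literature.RepresentationTheory.FiniteGroups.TracePow.matrix_trace_pow_eq_of_charpoly_eq`), and `k' = k^{φ(m) - 1}` (Euler) gives
`tr ρ g = tr ρ' g`.  Hence the two representations of `Q` on `ℂⁿ` have the same character and are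
equivalent (`Literature.RepresentationTheory.FiniteGroups.Representation.nonempty_equiv_of_character_eq`), and so are `ρ`, `ρ'`.  This
discharges the named fact `lemma32_complex` with no hypothesis (the printed proof invokes
Chebotarev; Frobenius' weaker theorem suffices because the statement compares characteristic
polynomials, which see all powers). [cite: DeligneSerreASENS1974, Lemme 3.2 and Rem. 3.3] -/
theorem lemma32_complex_holds : lemma32_complex := by
  intro n S ρ ρ' hfin hfin' _ _ hST
  classical
  -- the finite group `Q = (ρ × ρ')(Γ)` and `φ : Γ → Q`
  set π : absoluteGaloisGroup ℚ →* GL (Fin n) ℂ × GL (Fin n) ℂ :=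
    (ρ : absoluteGaloisGroup ℚ →* GL (Fin n) ℂ).prod (ρ' : absoluteGaloisGroup ℚ →* GL (Fin n) ℂ)
    with hπ
  set Q : Subgroup (GL (Fin n) ℂ × GL (Fin n) ℂ) := π.range with hQ
  haveI : Finite Q := by
    have h1 : (Set.range π).Finite := by
      refine (hfin.prod hfin').subset ?_
      rintro _ ⟨σ, rfl⟩
      exact ⟨⟨σ, rfl⟩, ⟨σ, rfl⟩⟩
    exact Set.Finite.to_subtype (s := ((Q : Subgroup (GL (Fin n) ℂ × GL (Fin n) ℂ)) :
      Set (GL (Fin n) ℂ × GL (Fin n) ℂ))) (by rw [hQ, MonoidHom.coe_range]; exact h1)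
  letI : Fintype Q := Fintype.ofFinite Q
  set φ : absoluteGaloisGroup ℚ →* Q := π.rangeRestrict with hφ
  have hφsurj : Function.Surjective φ := MonoidHom.rangeRestrict_surjective π
  have hφ_coe : ∀ σ, ((φ σ : Q) : GL (Fin n) ℂ × GL (Fin n) ℂ) = (ρ σ, ρ' σ) := fun σ ↦ rfl
  have hker : IsOpen ((φ.ker : Subgroup (absoluteGaloisGroup ℚ)) :
      Set (absoluteGaloisGroup ℚ)) := by
    have h1 := isOpen_fiber_of_finite_range ρ.continuous hfin 1
    have h2 := isOpen_fiber_of_finite_range ρ'.continuous hfin' 1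
    have : ((φ.ker : Subgroup (absoluteGaloisGroup ℚ)) : Set (absoluteGaloisGroup ℚ)) =
        ρ ⁻¹' {1} ∩ ρ' ⁻¹' {1} := by
      ext σ
      simp only [SetLike.mem_coe, MonoidHom.mem_ker, Set.mem_inter_iff, Set.mem_preimage,
        Set.mem_singleton_iff, ← Subtype.coe_inj, hφ_coe, OneMemClass.coe_one, Prod.mk_eq_one]
    rw [this]
    exact h1.inter h2
  -- the two representations of `Q` on `ℂⁿ`
  set τ : Representation ℂ Q (Fin n → ℂ) :=
    (glStdRepresentation (Fin n) ℂ).comp ((MonoidHom.fst _ _).comp Q.subtype) with hτ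
  set τ' : Representation ℂ Q (Fin n → ℂ) :=
    (glStdRepresentation (Fin n) ℂ).comp ((MonoidHom.snd _ _).comp Q.subtype) with hτ'
  have hτρ : ∀ σ, τ (φ σ) = FramedRep.toRepresentation ρ σ := fun σ ↦ rfl
  have hτρ' : ∀ σ, τ' (φ σ) = FramedRep.toRepresentation ρ' σ := fun σ ↦ rfl
  -- powers in `Q` project to powers of `ρ`, `ρ'`
  have hpow1 : ∀ (g : absoluteGaloisGroup ℚ) (k : ℕ),
      ((φ g ^ k : Q) : GL (Fin n) ℂ × GL (Fin n) ℂ).1 = ρ g ^ k := fun g k ↦ by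
    rw [SubmonoidClass.coe_pow, Prod.pow_fst, hφ_coe]
  have hpow2 : ∀ (g : absoluteGaloisGroup ℚ) (k : ℕ),
      ((φ g ^ k : Q) : GL (Fin n) ℂ × GL (Fin n) ℂ).2 = ρ' g ^ k := fun g k ↦ by
    rw [SubmonoidClass.coe_pow, Prod.pow_snd, hφ_coe]
  -- equal characters
  have hchar : τ.character = τ'.character := by
    ext q
    obtain ⟨g, rfl⟩ := hφsurj q
    obtain ⟨v, hvS, 𝔓, h𝔓, σ, hσ, k, hk, hφσ⟩ := exists_frob_eq_pow φ hker S g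
    obtain ⟨-, -, P, hP, hP'⟩ := hST v hvS
    have h1 := hP 𝔓 h𝔓 σ hσ
    have h2 := hP' 𝔓 h𝔓 σ hσ
    simp only [FramedRep.charpoly] at h1 h2
    -- `ρ σ = ρ g ^ k`, `ρ' σ = ρ' g ^ k`
    have hρσ : ρ σ = ρ g ^ k := by
      have := congrArg (fun q : Q ↦ (q : GL (Fin n) ℂ × GL (Fin n) ℂ).1) hφσ
      simpa only [hφ_coe, hpow1] using this
    have hρ'σ : ρ' σ = ρ' g ^ k := by
      have := congrArg (fun q : Q ↦ (q : GL (Fin n) ℂ × GL (Fin n) ℂ).2) hφσ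
      simpa only [hφ_coe, hpow2] using this
    -- the common order `m` of `φ g`
    set m : ℕ := orderOf (φ g) with hm
    have hm0 : 0 < m := orderOf_pos (φ g)
    have hgm : φ g ^ m = 1 := pow_orderOf_eq_one (φ g)
    have hρm : ρ g ^ m = 1 := by
      have := congrArg (fun q : Q ↦ (q : GL (Fin n) ℂ × GL (Fin n) ℂ).1) hgm
      simpa only [hpow1, OneMemClass.coe_one, Prod.fst_one] using this
    have hρ'm : ρ' g ^ m = 1 := by
      have := congrArg (fun q : Q ↦ (q : GL (Fin n) ℂ × GL (Fin n) ℂ).2) hgm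
      simpa only [hpow2, OneMemClass.coe_one, Prod.snd_one] using this
    -- `k k' ≡ 1 (mod m)` with `k' = k ^ (φ m - 1)` (Euler)
    set j : ℕ := k ^ (m.totient - 1) with hj
    have hkj : (k * j) % m = 1 % m := by
      have ht : 0 < m.totient := Nat.totient_pos.mpr hm0
      have : k * j = k ^ m.totient := by
        rw [hj, ← pow_succ', Nat.sub_add_cancel ht]
      rw [this]
      exact Nat.ModEq.pow_totient hk
    -- the matrices `M = ρ g`, `M' = ρ' g`
    set M : Matrix (Fin n) (Fin n) ℂ := ((ρ g : GL (Fin n) ℂ) : Matrix (Fin n) (Fin n) ℂ) with hM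
    set M' : Matrix (Fin n) (Fin n) ℂ := ((ρ' g : GL (Fin n) ℂ) : Matrix (Fin n) (Fin n) ℂ)
      with hM'
    have hMm : M ^ m = 1 := by rw [hM, ← Units.val_pow_eq_pow_val, hρm, Units.val_one]
    have hM'm : M' ^ m = 1 := by rw [hM', ← Units.val_pow_eq_pow_val, hρ'm, Units.val_one]
    have hch : (M ^ k).charpoly = (M' ^ k).charpoly := by
      rw [hM, hM', ← Units.val_pow_eq_pow_val, ← Units.val_pow_eq_pow_val, ← hρσ, ← hρ'σ]
      exact h1.trans h2.symm
    have hMkm : (M ^ k) ^ m = 1 := by rw [← pow_mul, mul_comm, pow_mul, hMm, one_pow]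
    have hM'km : (M' ^ k) ^ m = 1 := by rw [← pow_mul, mul_comm, pow_mul, hM'm, one_pow]
    have hmC : (m : ℂ) ≠ 0 := Nat.cast_ne_zero.mpr hm0.ne'
    have htr := Literature.RepresentationTheory.FiniteGroups.TracePow.matrix_trace_pow_eq_of_charpoly_eq hmC hMkm hM'km hch j
    have hred : ∀ {X : Matrix (Fin n) (Fin n) ℂ}, X ^ m = 1 → (X ^ k) ^ j = X := by
      intro X hX
      rw [← pow_mul, pow_eq_pow_mod (k * j) hX, hkj, ← pow_eq_pow_mod 1 hX, pow_one]
    rw [hred hMm, hred hM'm] at htr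
    -- conclude `tr τ (φ g) = tr τ' (φ g)`
    rw [Representation.character, Representation.character, hτρ, hτρ']
    have e1 : ∀ (ψ : FramedGaloisRep ℚ ℂ n), FramedRep.toRepresentation ψ g =
        Matrix.toLin' ((ψ g : GL (Fin n) ℂ) : Matrix (Fin n) (Fin n) ℂ) := fun ψ ↦
      LinearMap.ext fun w ↦ by simp [Matrix.toLin'_apply]
    rw [e1, e1, Matrix.trace_toLin'_eq, Matrix.trace_toLin'_eq]
    exact htr
  -- the representations of `Q` are equivalent, hence so are `ρ` and `ρ'`
  obtain ⟨e⟩ := Literature.RepresentationTheory.FiniteGroups.Representation.nonempty_equiv_of_character_eq τ τ' hchar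
  refine ⟨{ toRepEquiv := Representation.Equiv.mk e.toLinearEquiv fun σ ↦ ?_,
            continuous_toFun := ?_, continuous_invFun := ?_ }⟩
  · have := e.isIntertwining' (φ σ)
    rw [hτρ, hτρ'] at this
    exact this
  · exact e.toLinearEquiv.toLinearMap.continuous_of_finiteDimensional
  · exact e.toLinearEquiv.symm.toLinearMap.continuous_of_finiteDimensional

end Literature.NumberTheory.GaloisRepresentations.DeligneSerre1974
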